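import Mathlib
import Summits.Ventures.PercRepro2.Defs
import Summits.Ventures.PercRepro2.Independence
import Summits.Ventures.PercRepro2.Harris
import Summits.Ventures.PercRepro2.CoinDefs
import Summits.Ventures.PercRepro2.CoinArcsOff
import Summits.Ventures.PercRepro2.CoinPendantDefs
import Summits.Ventures.PercRepro2.CoinPendant
import Summits.Ventures.PercRepro2.CoinInduced
import Summits.Ventures.PercRepro2.CoinVdBK
import Summits.Ventures.PercRepro2.CoinBHK
import Summits.Ventures.PercRepro2.CoinReverse
import Summits.Ventures.PercRepro2.CoinLemmaA
import Summits.Ventures.PercRepro2.CoinDarcMixed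
import Summits.Ventures.PercRepro2.CoinTwoPendantDefs
import Summits.Ventures.PercRepro2.CoinTwoPendantMass
import Summits.Ventures.PercRepro2.CoinTraceLevels
import Summits.Ventures.PercRepro2.CoinTraceTower
import Summits.Ventures.PercRepro2.CoinTracePin
import Summits.Ventures.PercRepro2.CoinTraceReduce
import Summits.Ventures.PercRepro2.CoinTraceFn
import Summits.Ventures.PercRepro2.CoinTraceBlock
import Summits.Ventures.PercRepro2.CoinTraceShift
import Summits.Ventures.PercRepro2.CoinTwoStarAbstract
import Summits.Ventures.PercRepro2.CoinTwoStar
import Summits.Ventures.PercRepro2.CoinAbstractPendant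
import Summits.Ventures.PercRepro2.CoinFunctionalDefs
import Summits.Ventures.PercRepro2.CoinFunctionalReduce

/-!
# `AbstractPendantLemma ⟹ 2′DARC` in FUNCTIONAL form (blind cell PercRepro2, night-2 g3;
proofs/NIGHT2-DARC.md §22.1)

`darcF_of_abstractPendantLemma`: the reduction of `CoinAbstractPendant.lean` for increasing
`[0, 1]`-valued cluster functionals blind to the pendant set — the inputs are `shiftF` and
`massE_le_prob_of_le_one` instead of the marker lemmas; the trace law and its (AV-PA) are the same.
Hence every head whose abstract lemma is proved (two-vertex, pivotal pairs, 2-star, pathstar and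
two chains on their regimes) satisfies the row for such functionals with no further work.
-/

namespace Summit.Ventures.PercRepro2.Coin

section ReductionF

open Classical

variable {V : Type*} {E : Type*} [Fintype V] [DecidableEq V] [Fintype E] [DecidableEq E]
  {R : Type*} [Field R] [LinearOrder R] [IsStrictOrderedRing R]

/-- **`AbstractPendantLemma P w ⟹ DARCF` at every closed-out head with pendant set `P`**, for
increasing `[0, 1]`-valued cluster functionals blind to `P ∪ {t}`. -/
theorem darcF_of_abstractPendantLemma (p : E → R) (hp : IsProbVec p) {arcs : E → Finset (V × V)}
    (hS : SameEnds arcs) {P : Finset V} {t : V} (hclosed : ClosedOut arcs P {t})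
    (hT : TailCoinsIn arcs P {t}) (s u w : V) (hwP : w ∈ P)
    (hAPL : AbstractPendantLemma (R := R) P w) {F₁ F₂ : Set V → R}
    (hF₁ : Monotone F₁) (hF₂ : Monotone F₂) (hF₁0 : ∀ S, 0 ≤ F₁ S) (hF₂0 : ∀ S, 0 ≤ F₂ S)
    (hF₁1 : ∀ S, F₁ S ≤ 1) (hF₂1 : ∀ S, F₂ S ≤ 1)
    (hF₁b : ∀ S : Set V, F₁ (S \ ↑(P ∪ {t})) = F₁ S)
    (hF₂b : ∀ S : Set V, F₂ (S \ ↑(P ∪ {t})) = F₂ S) (hu : u ∉ P ∪ {t})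
    (hP : ∀ Z ∈ P.powerset, 0 < prob p (avoidEvent (arcsOff arcs (P ∪ {t})) s (Z ∪ {t})))
    (hQ : ∀ Z ∈ P.powerset,
      0 < prob p (avoidEvent (arcsOff arcs (P ∪ {t})) s (gateTarget u w Z {t}))) :
    DARCF p arcs s {t} F₁ F₂ u w := by
  have hS₀ : SameEnds (arcsOff arcs (P ∪ {t})) := sameEnds_arcsOff hS _
  refine darcF_of_trace_functional p hp hS hclosed hT s u w hwP hF₁ hF₂ hF₁0 hF₂0 hF₁b hF₂b hu
    hQ ?_
  set D₀ := arcsOff arcs (P ∪ {t}) with hD₀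
  set X₀ : Config E → R := fun ω => F₁ (clusterC D₀ ω s) with hX₀
  set Y₀ : Config E → R := fun ω => F₂ (clusterC D₀ ω s) with hY₀
  -- the trace data
  set ℓ : Finset V → R := fun Z => prob p (traceLevel arcs {t} P Z) with hℓ
  set Pz : Finset V → R := fun Z => prob p (avoidEvent D₀ s (Z ∪ {t})) with hPz
  set Qz : Finset V → R := fun Z => prob p (avoidEvent D₀ s (gateTarget u w Z {t})) with hQz
  set Az : Finset V → R := fun Z => massE p X₀ (avoidEvent D₀ s (Z ∪ {t})) with hAz
  set Bz : Finset V → R := fun Z => massE p Y₀ (avoidEvent D₀ s (Z ∪ {t})) with hBz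
  set Ahz : Finset V → R := fun Z => massE p X₀ (avoidEvent D₀ s (gateTarget u w Z {t})) with hAhz
  set Bhz : Finset V → R := fun Z => massE p Y₀ (avoidEvent D₀ s (gateTarget u w Z {t})) with hBhz
  have hPpos : ∀ Z : Finset V, Z ⊆ P → 0 < Pz Z := fun Z hZ => hP Z (Finset.mem_powerset.mpr hZ)
  have hQpos : ∀ Z : Finset V, Z ⊆ P → 0 < Qz Z := fun Z hZ => hQ Z (Finset.mem_powerset.mpr hZ)
  -- the abstract data
  have hMX : ∑ Z ∈ P.powerset, Az Z / Pz Z * (ℓ Z * Pz Z) = ∑ Z ∈ P.powerset, ℓ Z * Az Z := by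
    refine Finset.sum_congr rfl fun Z hZ => ?_
    have := (hPpos Z (Finset.mem_powerset.mp hZ)).ne'
    field_simp
  have hMY : ∑ Z ∈ P.powerset, Bz Z / Pz Z * (ℓ Z * Pz Z) = ∑ Z ∈ P.powerset, ℓ Z * Bz Z := by
    refine Finset.sum_congr rfl fun Z hZ => ?_
    have := (hPpos Z (Finset.mem_powerset.mp hZ)).ne'
    field_simp
  have key : ∑ Z ∈ P.powerset, ℓ Z * Pz Z * (Qz Z / Pz Z) *
        (Ahz Z / Qz Z * (∑ Z' ∈ P.powerset, ℓ Z' * Pz Z')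
          - ∑ Z' ∈ P.powerset, Az Z' / Pz Z' * (ℓ Z' * Pz Z')) *
        (Bhz Z / Qz Z * (∑ Z' ∈ P.powerset, ℓ Z' * Pz Z')
          - ∑ Z' ∈ P.powerset, Bz Z' / Pz Z' * (ℓ Z' * Pz Z')) =
      ∑ Z ∈ P.powerset, ℓ Z * Qz Z *
        (Ahz Z / Qz Z * (∑ Z' ∈ P.powerset, ℓ Z' * Pz Z') - ∑ Z' ∈ P.powerset, ℓ Z' * Az Z') *
        (Bhz Z / Qz Z * (∑ Z' ∈ P.powerset, ℓ Z' * Pz Z') - ∑ Z' ∈ P.powerset, ℓ Z' * Bz Z') := by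
    rw [hMX, hMY]
    refine Finset.sum_congr rfl fun Z hZ => ?_
    have := (hPpos Z (Finset.mem_powerset.mp hZ)).ne'
    field_simp
  rw [← key]
  -- the hypotheses of the abstract lemma
  have hμ : ∀ Z ∈ P.powerset, 0 ≤ ℓ Z * Pz Z :=
    fun Z _ => mul_nonneg (prob_nonneg hp _) (prob_nonneg hp _)
  have hx1 : ∀ Z : Finset V, Z ⊆ P → Az Z / Pz Z ≤ 1 := fun Z hZ =>
    (div_le_one₀ (hPpos Z hZ)).mpr (massE_le_prob_of_le_one p hp (fun ω => hF₁1 _) _)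
  have hy1 : ∀ Z : Finset V, Z ⊆ P → Bz Z / Pz Z ≤ 1 := fun Z hZ =>
    (div_le_one₀ (hPpos Z hZ)).mpr (massE_le_prob_of_le_one p hp (fun ω => hF₂1 _) _)
  have hxh1 : ∀ Z : Finset V, Z ⊆ P → Ahz Z / Qz Z ≤ 1 := fun Z hZ =>
    (div_le_one₀ (hQpos Z hZ)).mpr (massE_le_prob_of_le_one p hp (fun ω => hF₁1 _) _)
  have hyh1 : ∀ Z : Finset V, Z ⊆ P → Bhz Z / Qz Z ≤ 1 := fun Z hZ =>
    (div_le_one₀ (hQpos Z hZ)).mpr (massE_le_prob_of_le_one p hp (fun ω => hF₂1 _) _)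
  have hxanti : ∀ Z Z' : Finset V, Z ⊆ Z' → Z' ⊆ P → Az Z' / Pz Z' ≤ Az Z / Pz Z :=
    fun Z Z' hZZ' hZ'P => (div_le_div_iff₀ (hPpos Z' hZ'P) (hPpos Z (hZZ'.trans hZ'P))).mpr
      (shiftF p hp hS₀ s hF₁ hF₁0 (Finset.union_subset_union_left hZZ'))
  have hyanti : ∀ Z Z' : Finset V, Z ⊆ Z' → Z' ⊆ P → Bz Z' / Pz Z' ≤ Bz Z / Pz Z :=
    fun Z Z' hZZ' hZ'P => (div_le_div_iff₀ (hPpos Z' hZ'P) (hPpos Z (hZZ'.trans hZ'P))).mpr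
      (shiftF p hp hS₀ s hF₂ hF₂0 (Finset.union_subset_union_left hZZ'))
  have hxhanti : ∀ Z Z' : Finset V, Z ⊆ Z' → Z' ⊆ P → Ahz Z' / Qz Z' ≤ Ahz Z / Qz Z :=
    fun Z Z' hZZ' hZ'P => (div_le_div_iff₀ (hQpos Z' hZ'P) (hQpos Z (hZZ'.trans hZ'P))).mpr
      (shiftF p hp hS₀ s hF₁ hF₁0 (gateTarget_mono u w hZZ' {t}))
  have hyhanti : ∀ Z Z' : Finset V, Z ⊆ Z' → Z' ⊆ P → Bhz Z' / Qz Z' ≤ Bhz Z / Qz Z :=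
    fun Z Z' hZZ' hZ'P => (div_le_div_iff₀ (hQpos Z' hZ'P) (hQpos Z (hZZ'.trans hZ'P))).mpr
      (shiftF p hp hS₀ s hF₂ hF₂0 (gateTarget_mono u w hZZ' {t}))
  have hxh_le : ∀ Z : Finset V, Z ⊆ P → Ahz Z / Qz Z ≤ Az Z / Pz Z := fun Z hZ =>
    (div_le_div_iff₀ (hQpos Z hZ) (hPpos Z hZ)).mpr
      (shiftF p hp hS₀ s hF₁ hF₁0 (subset_gateTarget u w Z {t}))
  have hyh_le : ∀ Z : Finset V, Z ⊆ P → Bhz Z / Qz Z ≤ Bz Z / Pz Z := fun Z hZ =>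
    (div_le_div_iff₀ (hQpos Z hZ) (hPpos Z hZ)).mpr
      (shiftF p hp hS₀ s hF₂ hF₂0 (subset_gateTarget u w Z {t}))
  have hxh_eq : ∀ Z : Finset V, Z ⊆ P → w ∉ Z → Ahz Z / Qz Z = Az Z / Pz Z := by
    intro Z _ hwZ
    show massE p X₀ (avoidEvent D₀ s (gateTarget u w Z {t})) /
        prob p (avoidEvent D₀ s (gateTarget u w Z {t})) = _
    rw [gateTarget_of_notMem hwZ]
  have hyh_eq : ∀ Z : Finset V, Z ⊆ P → w ∉ Z → Bhz Z / Qz Z = Bz Z / Pz Z := by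
    intro Z _ hwZ
    show massE p Y₀ (avoidEvent D₀ s (gateTarget u w Z {t})) /
        prob p (avoidEvent D₀ s (gateTarget u w Z {t})) = _
    rw [gateTarget_of_notMem hwZ]
  have hρ1 : ∀ Z ∈ P.powerset, w ∉ Z → Qz Z / Pz Z = 1 := by
    intro Z hZ hwZ
    show prob p (avoidEvent D₀ s (gateTarget u w Z {t})) / prob p (avoidEvent D₀ s (Z ∪ {t})) = 1
    rw [gateTarget_of_notMem hwZ]
    exact div_self (hP Z hZ).ne'
  have hρ0 : ∀ Z ∈ P.powerset, 0 ≤ Qz Z / Pz Z :=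
    fun Z _ => div_nonneg (prob_nonneg hp _) (prob_nonneg hp _)
  have hρle : ∀ Z ∈ P.powerset, Qz Z / Pz Z ≤ 1 := fun Z hZ =>
    (div_le_one₀ (hP Z hZ)).mpr
      (prob_mono hp fun ω hω t' ht' => hω t' (subset_gateTarget u w Z {t} ht'))
  have hρmono : ∀ Z Z' : Finset V, Z ⊆ Z' → Z' ⊆ P → w ∈ Z → Qz Z / Pz Z ≤ Qz Z' / Pz Z' :=
    fun Z Z' hZZ' hZ'P hw =>
      (div_le_div_iff₀ (hPpos Z (hZZ'.trans hZ'P)) (hPpos Z' hZ'P)).mpr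
        (rho_mono_of_subset p hp hS s u w hu hZZ' hZ'P hw)
  have hPA : TracePA P (fun Z => ℓ Z * Pz Z) := by
    intro U hU f₁ f₂ h₁ h₂ h₁0 h₂0
    have h := trace_pa p hp hS hclosed hT hU s (monotone_traceFn P h₁) (monotone_traceFn P h₂)
      (traceFn_nonneg P h₁0) (traceFn_nonneg P h₂0)
    have e₁ : ∑ Z ∈ P.powerset.filter (fun Z => Disjoint Z U),
        traceFn P f₁ ↑Z * (ℓ Z * Pz Z) =
        ∑ Z ∈ P.powerset.filter (fun Z => Disjoint Z U), f₁ Z * (ℓ Z * Pz Z) :=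
      Finset.sum_congr rfl fun Z hZ => by
        rw [traceFn_coe P f₁ (Finset.mem_powerset.mp (Finset.mem_filter.mp hZ).1)]
    have e₂ : ∑ Z ∈ P.powerset.filter (fun Z => Disjoint Z U),
        traceFn P f₂ ↑Z * (ℓ Z * Pz Z) =
        ∑ Z ∈ P.powerset.filter (fun Z => Disjoint Z U), f₂ Z * (ℓ Z * Pz Z) :=
      Finset.sum_congr rfl fun Z hZ => by
        rw [traceFn_coe P f₂ (Finset.mem_powerset.mp (Finset.mem_filter.mp hZ).1)]
    have e₁₂ : ∑ Z ∈ P.powerset.filter (fun Z => Disjoint Z U),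
        traceFn P f₁ ↑Z * traceFn P f₂ ↑Z * (ℓ Z * Pz Z) =
        ∑ Z ∈ P.powerset.filter (fun Z => Disjoint Z U), f₁ Z * f₂ Z * (ℓ Z * Pz Z) :=
      Finset.sum_congr rfl fun Z hZ => by
        rw [traceFn_coe P f₁ (Finset.mem_powerset.mp (Finset.mem_filter.mp hZ).1),
          traceFn_coe P f₂ (Finset.mem_powerset.mp (Finset.mem_filter.mp hZ).1)]
    rw [e₁, e₂, e₁₂] at h
    exact h
  exact hAPL (fun Z => ℓ Z * Pz Z) (fun Z => Az Z / Pz Z) (fun Z => Bz Z / Pz Z)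
    (fun Z => Ahz Z / Qz Z) (fun Z => Bhz Z / Qz Z) (fun Z => Qz Z / Pz Z) hμ hPA hx1 hy1 hxh1
    hyh1 hxanti hyanti hxhanti hyhanti hxh_le hyh_le hxh_eq hyh_eq hρ1 hρ0 hρle hρmono

end ReductionF

end Summit.Ventures.PercRepro2.Coin
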